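import Summits.KontsevichZagierPeriods.Zeta5Search.Certificates.RecordRayDualSeriesRate
import Summits.KontsevichZagierPeriods.Zeta5Search.Certificates.RecordRayDualSeries
import HarnessLib

/-!
# ζ(5) search — certificates: the record dual series — V: the two-sided exponential RATE of `F̃₇(b(a·n))/Z_n` (certifier 2)

HONEST FRAMING: systematic search; no irrationality claim unless certified.

OUR work (Summit side; CERTIFY-HOWTO §9 roadmap, step (D1) COMPLETE for the record direction `b = n·(41; 17,…,11)`).
With `Z_n = termNorm (41n) (Brec n) = (41n+1)!/∏_j ((41−2β_j)n+1)!` and `T̂ = termHat` (`DualSeriesTermBounds`):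

* `termHat_rec_eq`, `log_termHat_rec_le` — Stirling on the term: `log T̂(μ) ≤ log(41n+2μ+2) + H(n,μ) + ½Σ_j log M_j + 14`;
* `termHat_window_le` — on the window `2n ≤ 5(μ+1)`, `20μ ≤ 9n+20` (`n ≥ 100`): `T̂(μ) ≤ W_n`,
  `W_n = exp(n·(ĥ(2/5) + Λ⁺/20) + 2Λ⁺ + 96(1+log 42n) + (9/2)·log(43n+4) + 14)` (`RecordRayDualSeriesRate.Hrec_window_bound`);
* `termHat_le_W` — by unimodality (`RecordRayDualSeries`) EVERY `T̂(μ) ≤ W_n`, and `termHat_tail_le_W` — beyond `μ ≥ n`,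
  `T̂(μ) ≤ W_n·((n+1)/(μ+1))²`; `partial_sums_le` — `Σ_{μ<N} T̂(μ) ≤ 2(n+1)·W_n`;
* `vwpDual_record_upper` — `F̃₇(b(a·n)) ≤ Z_n·2(n+1)·W_n`; `vwpDual_record_lower` — `F̃₇(b(a·n)) ≥ Z_n·T̂(⌊11n/25⌋) ≥ Z_n·e^{n·ĥ(11/25) − O(log n)}`
  with `hhat044_ge : −125.5366 ≤ ĥ(11/25)`;
* RATES: `eventually_vwpDual_record_le_exp` / `eventually_exp_le_vwpDual_record`: for every `ε > 0`, eventually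
  `e^{(−125.5366−ε)n} ≤ F̃₇(b(a·n))/Z_n ≤ e^{(−125.5308+ε)n}` (true rate `sup ĥ = −125.536590…`; the upper slack `0.0058` is the
  window's tangent error, improvable by shrinking the window).

This is the first of the three DECAY inputs (F̃, W, ρ) for an unconditional exponent of the record ray (`RecordRayExponent`).
-/

noncomputable section

open Finset Real Filter Topology

namespace Summit.KontsevichZagierPeriods.Zeta5Search.RecordRay

open Summit.KontsevichZagierPeriods.Zeta5Search.DualSeries
open Summit.KontsevichZagierPeriods.Zeta5Search.DualSeriesBounds
open Summit.KontsevichZagierPeriods.Zeta5Search.LogEnclosures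
open Summit.KontsevichZagierPeriods.Zeta5Search.DualSeriesLemma19 (bRecord)
open Literature.NumberTheory.Irrationality.BrownZudilin2022 (vwpDual)
open Literature.Analysis.SpecialFunctions (log_choose_le_entropy log_choose_ge_entropy)

/-! ### The term as explicit binomials and Stirling -/

/-- The denominator binomials of the record term, explicitly. -/
theorem prod_choose_rec (n μ : ℕ) :
    (∏ j ∈ range 7, (((41 * n - Brec n j + μ + 1).choose (Brec n j + μ) : ℕ) : ℝ)) =
      ((24 * n + μ + 1).choose (17 * n + μ) : ℝ) * ((25 * n + μ + 1).choose (16 * n + μ) : ℝ)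
        * ((26 * n + μ + 1).choose (15 * n + μ) : ℝ) * ((27 * n + μ + 1).choose (14 * n + μ) : ℝ)
        * ((28 * n + μ + 1).choose (13 * n + μ) : ℝ) * ((29 * n + μ + 1).choose (12 * n + μ) : ℝ)
        * ((30 * n + μ + 1).choose (11 * n + μ) : ℝ) := by
  have e : ∀ j ∈ range 7, (((41 * n - Brec n j + μ + 1).choose (Brec n j + μ) : ℕ) : ℝ) =
      ((((24 + j) * n + μ + 1).choose ((17 - j) * n + μ) : ℕ) : ℝ) := by
    intro j hj
    have hj' := mem_range.1 hj
    unfold Brec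
    congr 2
    interval_cases j <;> omega
  rw [prod_congr rfl e]
  simp only [prod_range_succ, prod_range_zero, one_mul, Nat.sub_zero, add_zero]

/-- `H(n, μ)` expanded into its eight explicit entropy terms. -/
theorem Hrec_expand (n μ : ℝ) : Hrec n μ = ent (41 * n + μ + 1) μ -
    (ent (24 * n + μ + 1) (17 * n + μ) + ent (25 * n + μ + 1) (16 * n + μ) + ent (26 * n + μ + 1) (15 * n + μ)
      + ent (27 * n + μ + 1) (14 * n + μ) + ent (28 * n + μ + 1) (13 * n + μ) + ent (29 * n + μ + 1) (12 * n + μ)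
      + ent (30 * n + μ + 1) (11 * n + μ)) := by
  unfold Hrec
  simp only [sum_range_succ, sum_range_zero, zero_add, Nat.cast_zero, Nat.cast_one, Nat.cast_ofNat]
  norm_num

/-- Stirling's upper bound `log C(m,k) ≤ ent(m,k)` in our notation (naturals). -/
theorem log_choose_le_ent {m k : ℕ} (h : k ≤ m) : Real.log (m.choose k) ≤ ent m k := by
  have := log_choose_le_entropy h
  unfold ent; exact this

/-- Stirling's lower bound `ent(m,k) − log m/2 − 2 ≤ log C(m,k)` in our notation (naturals, `1 ≤ m`). -/
theorem ent_le_log_choose {m k : ℕ} (hm : 1 ≤ m) (h : k ≤ m) :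
    ent m k - Real.log m / 2 - 2 ≤ Real.log (m.choose k) := by
  have := log_choose_ge_entropy hm h
  unfold ent; exact this

/-- **Stirling on the record term**: `log T̂(μ) ≤ log(41n+2μ+2) + H(n,μ) + ½Σ_j log M_j + 14` (`M_j = (24+j)n+μ+1`). -/
theorem log_termHat_rec_le {n : ℕ} (hn : 1 ≤ n) (μ : ℕ) :
    Real.log (termHat (41 * n) (Brec n) μ) ≤ Real.log (41 * n + 2 * μ + 2) + Hrec n μ
      + (Real.log (24 * n + μ + 1) + Real.log (25 * n + μ + 1) + Real.log (26 * n + μ + 1) + Real.log (27 * n + μ + 1)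
        + Real.log (28 * n + μ + 1) + Real.log (29 * n + μ + 1) + Real.log (30 * n + μ + 1)) / 2 + 14 := by
  unfold termHat
  rw [prod_choose_rec]
  have c0 : (0 : ℝ) < ((41 * n + μ + 1).choose μ : ℝ) := by exact_mod_cast Nat.choose_pos (by omega)
  have c1 : (0 : ℝ) < ((24 * n + μ + 1).choose (17 * n + μ) : ℝ) := by exact_mod_cast Nat.choose_pos (by omega)
  have c2 : (0 : ℝ) < ((25 * n + μ + 1).choose (16 * n + μ) : ℝ) := by exact_mod_cast Nat.choose_pos (by omega)
  have c3 : (0 : ℝ) < ((26 * n + μ + 1).choose (15 * n + μ) : ℝ) := by exact_mod_cast Nat.choose_pos (by omega)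
  have c4 : (0 : ℝ) < ((27 * n + μ + 1).choose (14 * n + μ) : ℝ) := by exact_mod_cast Nat.choose_pos (by omega)
  have c5 : (0 : ℝ) < ((28 * n + μ + 1).choose (13 * n + μ) : ℝ) := by exact_mod_cast Nat.choose_pos (by omega)
  have c6 : (0 : ℝ) < ((29 * n + μ + 1).choose (12 * n + μ) : ℝ) := by exact_mod_cast Nat.choose_pos (by omega)
  have c7 : (0 : ℝ) < ((30 * n + μ + 1).choose (11 * n + μ) : ℝ) := by exact_mod_cast Nat.choose_pos (by omega)
  have hA : (0 : ℝ) < ((41 * n + 2 * μ + 2 : ℕ) : ℝ) := by positivity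
  rw [Real.log_div (by positivity) (by positivity), Real.log_mul hA.ne' c0.ne',
    Real.log_mul (by positivity) c7.ne', Real.log_mul (by positivity) c6.ne', Real.log_mul (by positivity) c5.ne',
    Real.log_mul (by positivity) c4.ne', Real.log_mul (by positivity) c3.ne', Real.log_mul c1.ne' c2.ne']
  have u0 := log_choose_le_ent (show μ ≤ 41 * n + μ + 1 by omega)
  have l1 := ent_le_log_choose (show 1 ≤ 24 * n + μ + 1 by omega) (show 17 * n + μ ≤ 24 * n + μ + 1 by omega)
  have l2 := ent_le_log_choose (show 1 ≤ 25 * n + μ + 1 by omega) (show 16 * n + μ ≤ 25 * n + μ + 1 by omega)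
  have l3 := ent_le_log_choose (show 1 ≤ 26 * n + μ + 1 by omega) (show 15 * n + μ ≤ 26 * n + μ + 1 by omega)
  have l4 := ent_le_log_choose (show 1 ≤ 27 * n + μ + 1 by omega) (show 14 * n + μ ≤ 27 * n + μ + 1 by omega)
  have l5 := ent_le_log_choose (show 1 ≤ 28 * n + μ + 1 by omega) (show 13 * n + μ ≤ 28 * n + μ + 1 by omega)
  have l6 := ent_le_log_choose (show 1 ≤ 29 * n + μ + 1 by omega) (show 12 * n + μ ≤ 29 * n + μ + 1 by omega)
  have l7 := ent_le_log_choose (show 1 ≤ 30 * n + μ + 1 by omega) (show 11 * n + μ ≤ 30 * n + μ + 1 by omega)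
  push_cast at u0 l1 l2 l3 l4 l5 l6 l7 ⊢
  rw [Hrec_expand]
  linarith

/-! ### The window bound and the global bound -/

/-- The window maximum `W_n`. -/
def Wn (n : ℕ) : ℝ :=
  Real.exp ((n : ℝ) * (hhat04 + lambdaPlus / 20) + 2 * lambdaPlus + 96 * (1 + Real.log (42 * n))
    + 9 / 2 * Real.log (43 * n + 4) + 14)

/-- **Window bound**: for `n ≥ 100`, `2n ≤ 5(μ+1)`, `20μ ≤ 9n + 20`: `T̂(μ) ≤ W_n`. -/
theorem termHat_window_le {n μ : ℕ} (hn : 100 ≤ n) (hlo : 2 * n ≤ 5 * (μ + 1)) (hhi : 20 * μ ≤ 9 * n + 20) :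
    termHat (41 * n) (Brec n) μ ≤ Wn n := by
  have hT := termHat_pos (B₀ := 41 * n) (hreg_rec n) μ
  rw [Wn, ← Real.exp_log hT]
  apply Real.exp_le_exp.mpr
  have h1 := log_termHat_rec_le (show 1 ≤ n by omega) μ
  have hn' : (100 : ℝ) ≤ n := by exact_mod_cast hn
  have hlo' : (2 : ℝ) * n ≤ 5 * (μ + 1) := by exact_mod_cast hlo
  have hhi' : (20 : ℝ) * μ ≤ 9 * n + 20 := by exact_mod_cast hhi
  have h2 := Hrec_window_bound (n := (n : ℝ)) (μ := (μ : ℝ)) hn' (by linarith) (by linarith)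
  have hμ0 : (0 : ℝ) ≤ μ := Nat.cast_nonneg μ
  -- the logarithms of the window are ≤ log(43n+4)
  have m0 : Real.log (41 * n + 2 * μ + 2) ≤ Real.log (43 * n + 4) := Real.log_le_log (by positivity) (by linarith)
  have m1 : Real.log (24 * n + μ + 1) ≤ Real.log (43 * n + 4) := Real.log_le_log (by positivity) (by linarith)
  have m2 : Real.log (25 * n + μ + 1) ≤ Real.log (43 * n + 4) := Real.log_le_log (by positivity) (by linarith)
  have m3 : Real.log (26 * n + μ + 1) ≤ Real.log (43 * n + 4) := Real.log_le_log (by positivity) (by linarith)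
  have m4 : Real.log (27 * n + μ + 1) ≤ Real.log (43 * n + 4) := Real.log_le_log (by positivity) (by linarith)
  have m5 : Real.log (28 * n + μ + 1) ≤ Real.log (43 * n + 4) := Real.log_le_log (by positivity) (by linarith)
  have m6 : Real.log (29 * n + μ + 1) ≤ Real.log (43 * n + 4) := Real.log_le_log (by positivity) (by linarith)
  have m7 : Real.log (30 * n + μ + 1) ≤ Real.log (43 * n + 4) := Real.log_le_log (by positivity) (by linarith)
  linarith

/-- The lower window index `⌊(2n−1)/5⌋`. -/
def μlo (n : ℕ) : ℕ := (2 * n - 1) / 5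
/-- The upper window index `⌈9n/20⌉ = ⌊(9n+19)/20⌋`. -/
def μhi (n : ℕ) : ℕ := (9 * n + 19) / 20

/-- **Every normalised term is `≤ W_n`** (`n ≥ 100`): unimodality + the window bound. -/
theorem termHat_le_W {n : ℕ} (hn : 100 ≤ n) (μ : ℕ) : termHat (41 * n) (Brec n) μ ≤ Wn n := by
  have hlo1 : 5 * μlo n ≤ 2 * n - 1 := by unfold μlo; omega
  have hlo2 : 2 * n ≤ 5 * (μlo n + 1) := by unfold μlo; omega
  have hhi1 : 20 * μhi n ≤ 9 * n + 19 := by unfold μhi; omega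
  have hhi2 : 9 * n ≤ 20 * μhi n := by unfold μhi; omega
  rcases le_or_gt μ (μlo n) with hμ | hμ
  · -- increasing part
    have step : ∀ ν, ν < μlo n → termHat (41 * n) (Brec n) ν ≤ termHat (41 * n) (Brec n) (ν + 1) :=
      fun ν hν => termHat_rec_le_succ (by omega)
    exact (termHat_le_of_increasing step hμ).trans (termHat_window_le hn hlo2 (by omega))
  rcases le_or_gt μ (μhi n) with hμ' | hμ'
  · exact termHat_window_le hn (by omega) (by omega)
  · -- decreasing part
    have step : ∀ ν, μhi n ≤ ν → termHat (41 * n) (Brec n) (ν + 1) ≤ termHat (41 * n) (Brec n) ν :=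
      fun ν hν => termHat_rec_succ_le (by omega)
    exact (termHat_le_of_decreasing step hμ'.le).trans (termHat_window_le hn (by omega) (by omega))

/-- **Tail**: for `μ ≥ n` (`n ≥ 100`), `T̂(μ) ≤ W_n·((n+1)/(μ+1))²`. -/
theorem termHat_tail_le_W {n μ : ℕ} (hn : 100 ≤ n) (hμ : n ≤ μ) :
    termHat (41 * n) (Brec n) μ ≤ Wn n * (((n : ℝ) + 1) / ((μ : ℝ) + 1)) ^ 2 := by
  have h := termHat_le_of_tail (B₀ := 41 * n) (B := Brec n) (μ₃ := n) (fun ν hν => termHat_rec_tail hν) hμ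
  have hW := termHat_le_W hn n
  have h0 : 0 ≤ (((n : ℝ) + 1) / ((μ : ℝ) + 1)) ^ 2 := by positivity
  exact h.trans (mul_le_mul_of_nonneg_right hW h0)

/-- **Partial sums**: `Σ_{μ<N} T̂(μ) ≤ 2(n+1)·W_n` for every `N` (`n ≥ 100`). -/
theorem partial_sums_le {n : ℕ} (hn : 100 ≤ n) (N : ℕ) :
    ∑ μ ∈ range N, termHat (41 * n) (Brec n) μ ≤ 2 * ((n : ℝ) + 1) * Wn n := by
  have hW0 : 0 ≤ Wn n := (Real.exp_pos _).le
  have hT0 : ∀ μ, 0 ≤ termHat (41 * n) (Brec n) μ := fun μ => (termHat_pos (B₀ := 41 * n) (hreg_rec n) μ).le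
  rcases le_or_gt N (n + 1) with hN | hN
  · calc ∑ μ ∈ range N, termHat (41 * n) (Brec n) μ ≤ ∑ _μ ∈ range N, Wn n := sum_le_sum fun μ _ => termHat_le_W hn μ
      _ = N * Wn n := by rw [sum_const, card_range, nsmul_eq_mul]
      _ ≤ 2 * ((n : ℝ) + 1) * Wn n := by
          have : (N : ℝ) ≤ n + 1 := by exact_mod_cast hN
          nlinarith
  · -- induction on N ≥ n+1 with the telescoping majorant
    have key : ∀ N, n + 1 ≤ N → ∑ μ ∈ range N, termHat (41 * n) (Brec n) μ ≤
        ((n : ℝ) + 1) * Wn n + Wn n * ((n : ℝ) + 1) ^ 2 * (1 / ((n : ℝ) + 1) - 1 / (N : ℝ)) := by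
      intro N hN
      induction N, hN using Nat.le_induction with
      | base =>
        have h1 : ∑ μ ∈ range (n + 1), termHat (41 * n) (Brec n) μ ≤ ((n : ℝ) + 1) * Wn n := by
          calc ∑ μ ∈ range (n + 1), termHat (41 * n) (Brec n) μ ≤ ∑ _μ ∈ range (n + 1), Wn n :=
                sum_le_sum fun μ _ => termHat_le_W hn μ
            _ = ((n : ℝ) + 1) * Wn n := by rw [sum_const, card_range, nsmul_eq_mul]; push_cast; ring
        have h2 : (1 / ((n : ℝ) + 1) - 1 / ((n + 1 : ℕ) : ℝ)) = 0 := by push_cast; ring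
        rw [h2]; linarith
      | succ N hN ih =>
        rw [sum_range_succ]
        have hNpos : (0 : ℝ) < N := by exact_mod_cast (show 0 < N by omega)
        have ht := termHat_tail_le_W hn (show n ≤ N by omega)
        -- ((n+1)/(N+1))² ≤ (n+1)² (1/N − 1/(N+1))
        have hsq : (((n : ℝ) + 1) / ((N : ℝ) + 1)) ^ 2 ≤ ((n : ℝ) + 1) ^ 2 * (1 / (N : ℝ) - 1 / ((N : ℝ) + 1)) := by
          rw [div_pow]
          have e : 1 / (N : ℝ) - 1 / ((N : ℝ) + 1) = 1 / ((N : ℝ) * ((N : ℝ) + 1)) := by field_simp; ring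
          rw [e, ← div_eq_mul_one_div]
          apply div_le_div_of_nonneg_left (by positivity) (by positivity)
          nlinarith
        have hstep : termHat (41 * n) (Brec n) N ≤ Wn n * ((n : ℝ) + 1) ^ 2 * (1 / (N : ℝ) - 1 / ((N : ℝ) + 1)) := by
          calc termHat (41 * n) (Brec n) N ≤ Wn n * (((n : ℝ) + 1) / ((N : ℝ) + 1)) ^ 2 := ht
            _ ≤ Wn n * (((n : ℝ) + 1) ^ 2 * (1 / (N : ℝ) - 1 / ((N : ℝ) + 1))) := mul_le_mul_of_nonneg_left hsq hW0
            _ = _ := by ring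
        have hc : ((N + 1 : ℕ) : ℝ) = (N : ℝ) + 1 := by push_cast; ring
        rw [hc]
        linarith
    have h := key N hN.le
    have hNpos : (0 : ℝ) < N := by exact_mod_cast (show 0 < N by omega)
    have hinv : 0 ≤ 1 / (N : ℝ) := by positivity
    have hn1 : (0 : ℝ) < (n : ℝ) + 1 := by positivity
    have e : Wn n * ((n : ℝ) + 1) ^ 2 * (1 / ((n : ℝ) + 1)) = ((n : ℝ) + 1) * Wn n := by field_simp
    nlinarith [mul_nonneg (mul_nonneg hW0 (sq_nonneg ((n : ℝ) + 1))) hinv]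

/-! ### Two-sided bounds for `F̃₇(b(a·n))` and the rate -/

/-- **Upper bound**: `F̃₇(b(a·n)) ≤ Z_n·2(n+1)·W_n` (`n ≥ 100`). -/
theorem vwpDual_record_upper {n : ℕ} (hn : 100 ≤ n) :
    vwpDual 7 (bRecord n) ≤ termNorm (41 * n) (Brec n) * (2 * ((n : ℝ) + 1) * Wn n) :=
  vwpDual_record_le (partial_sums_le hn)

/-- `ĥ(11/25) = e(1036/25, 11/25) − Σ_j e((1036−25β_j)/25, (25β_j+11)/25)` (the lattice slope `0.44 ≈ ν* = 0.44080…`). -/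
def hhat044 : ℝ :=
  ent (1036 / 25) (11 / 25) - (ent (611 / 25) (436 / 25) + ent (636 / 25) (411 / 25) + ent (661 / 25) (386 / 25)
    + ent (686 / 25) (361 / 25) + ent (711 / 25) (336 / 25) + ent (736 / 25) (311 / 25) + ent (761 / 25) (286 / 25))

/-- **`−125.5366 ≤ ĥ(11/25)`** (certified logarithms; `ĥ(11/25) = −125.536591…`). -/
theorem hhat044_ge : (-1255366 / 10000 : ℝ) ≤ hhat044 := by
  unfold hhat044 ent
  norm_num only
  have d1 : Real.log (1036 / 25 : ℝ) = Real.log 1036 - Real.log 25 := Real.log_div (by norm_num) (by norm_num)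
  have d2 : Real.log (11 / 25 : ℝ) = Real.log 11 - Real.log 25 := Real.log_div (by norm_num) (by norm_num)
  have d3 : Real.log (611 / 25 : ℝ) = Real.log 611 - Real.log 25 := Real.log_div (by norm_num) (by norm_num)
  have d4 : Real.log (436 / 25 : ℝ) = Real.log 436 - Real.log 25 := Real.log_div (by norm_num) (by norm_num)
  have d5 : Real.log (636 / 25 : ℝ) = Real.log 636 - Real.log 25 := Real.log_div (by norm_num) (by norm_num)
  have d6 : Real.log (411 / 25 : ℝ) = Real.log 411 - Real.log 25 := Real.log_div (by norm_num) (by norm_num)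
  have d7 : Real.log (661 / 25 : ℝ) = Real.log 661 - Real.log 25 := Real.log_div (by norm_num) (by norm_num)
  have d8 : Real.log (386 / 25 : ℝ) = Real.log 386 - Real.log 25 := Real.log_div (by norm_num) (by norm_num)
  have d9 : Real.log (686 / 25 : ℝ) = Real.log 686 - Real.log 25 := Real.log_div (by norm_num) (by norm_num)
  have d10 : Real.log (361 / 25 : ℝ) = Real.log 361 - Real.log 25 := Real.log_div (by norm_num) (by norm_num)
  have d11 : Real.log (711 / 25 : ℝ) = Real.log 711 - Real.log 25 := Real.log_div (by norm_num) (by norm_num)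
  have d12 : Real.log (336 / 25 : ℝ) = Real.log 336 - Real.log 25 := Real.log_div (by norm_num) (by norm_num)
  have d13 : Real.log (736 / 25 : ℝ) = Real.log 736 - Real.log 25 := Real.log_div (by norm_num) (by norm_num)
  have d14 : Real.log (311 / 25 : ℝ) = Real.log 311 - Real.log 25 := Real.log_div (by norm_num) (by norm_num)
  have d15 : Real.log (761 / 25 : ℝ) = Real.log 761 - Real.log 25 := Real.log_div (by norm_num) (by norm_num)
  have d16 : Real.log (286 / 25 : ℝ) = Real.log 286 - Real.log 25 := Real.log_div (by norm_num) (by norm_num)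
  rw [d1, d2, d3, d4, d5, d6, d7, d8, d9, d10, d11, d12, d13, d14, d15, d16]
  obtain ⟨a1, a2⟩ := log_1036_bounds; obtain ⟨b1, b2⟩ := log_25_bounds
  obtain ⟨c1, c2⟩ := log_11_bounds; obtain ⟨e1, e2⟩ := log_41_bounds
  obtain ⟨f1, f2⟩ := log_611_bounds; obtain ⟨g1, g2⟩ := log_436_bounds
  obtain ⟨h1, h2⟩ := log_636_bounds; obtain ⟨i1, i2⟩ := log_411_bounds
  obtain ⟨j1, j2⟩ := log_661_bounds; obtain ⟨k1, k2⟩ := log_386_bounds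
  obtain ⟨l1, l2⟩ := log_686_bounds; obtain ⟨m1, m2⟩ := log_361_bounds
  obtain ⟨o1, o2⟩ := log_711_bounds; obtain ⟨p1, p2⟩ := log_336_bounds
  obtain ⟨q1, q2⟩ := log_736_bounds; obtain ⟨r1, r2⟩ := log_311_bounds
  obtain ⟨s1, s2⟩ := log_761_bounds; obtain ⟨t1, t2⟩ := log_286_bounds
  obtain ⟨u1, u2⟩ := log_7_bounds; obtain ⟨v1, v2⟩ := log_9_bounds
  obtain ⟨x1, x2⟩ := log_13_bounds; obtain ⟨y1, y2⟩ := log_15_bounds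
  obtain ⟨z1, z2⟩ := log_17_bounds; obtain ⟨aa1, aa2⟩ := log_19_bounds
  linarith

/-- The near-optimal lattice index `⌊11n/25⌋` (`ν* = 0.44080…`). -/
def μstar (n : ℕ) : ℕ := 11 * n / 25

/-- **Lower bound at the lattice index**: `log T̂(⌊11n/25⌋) ≥ n·ĥ(11/25) − 97·(1 + log(42n)) − 2` (`n ≥ 10`). -/
theorem log_termHat_μstar_ge {n : ℕ} (hn : 10 ≤ n) :
    (n : ℝ) * hhat044 - 97 * (1 + Real.log (42 * n)) - 2 ≤ Real.log (termHat (41 * n) (Brec n) (μstar n)) := by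
  have hμ1 : 25 * μstar n ≤ 11 * n := by unfold μstar; omega
  have hμ2 : 11 * n < 25 * (μstar n + 1) := by unfold μstar; omega
  set μ := μstar n with hμdef
  have hn' : (10 : ℝ) ≤ n := by exact_mod_cast hn
  have f1 : (25 : ℝ) * μ ≤ 11 * n := by exact_mod_cast hμ1
  have f2 : (11 : ℝ) * n < 25 * (μ + 1) := by exact_mod_cast hμ2
  unfold termHat
  rw [prod_choose_rec]
  have c0 : (0 : ℝ) < ((41 * n + μ + 1).choose μ : ℝ) := by exact_mod_cast Nat.choose_pos (by omega)
  have c1 : (0 : ℝ) < ((24 * n + μ + 1).choose (17 * n + μ) : ℝ) := by exact_mod_cast Nat.choose_pos (by omega)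
  have c2 : (0 : ℝ) < ((25 * n + μ + 1).choose (16 * n + μ) : ℝ) := by exact_mod_cast Nat.choose_pos (by omega)
  have c3 : (0 : ℝ) < ((26 * n + μ + 1).choose (15 * n + μ) : ℝ) := by exact_mod_cast Nat.choose_pos (by omega)
  have c4 : (0 : ℝ) < ((27 * n + μ + 1).choose (14 * n + μ) : ℝ) := by exact_mod_cast Nat.choose_pos (by omega)
  have c5 : (0 : ℝ) < ((28 * n + μ + 1).choose (13 * n + μ) : ℝ) := by exact_mod_cast Nat.choose_pos (by omega)
  have c6 : (0 : ℝ) < ((29 * n + μ + 1).choose (12 * n + μ) : ℝ) := by exact_mod_cast Nat.choose_pos (by omega)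
  have c7 : (0 : ℝ) < ((30 * n + μ + 1).choose (11 * n + μ) : ℝ) := by exact_mod_cast Nat.choose_pos (by omega)
  have hA : (0 : ℝ) < ((41 * n + 2 * μ + 2 : ℕ) : ℝ) := by positivity
  rw [Real.log_div (by positivity) (by positivity), Real.log_mul hA.ne' c0.ne',
    Real.log_mul (by positivity) c7.ne', Real.log_mul (by positivity) c6.ne', Real.log_mul (by positivity) c5.ne',
    Real.log_mul (by positivity) c4.ne', Real.log_mul (by positivity) c3.ne', Real.log_mul c1.ne' c2.ne']
  have l0 := ent_le_log_choose (show 1 ≤ 41 * n + μ + 1 by omega) (show μ ≤ 41 * n + μ + 1 by omega)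
  have u1 := log_choose_le_ent (show 17 * n + μ ≤ 24 * n + μ + 1 by omega)
  have u2 := log_choose_le_ent (show 16 * n + μ ≤ 25 * n + μ + 1 by omega)
  have u3 := log_choose_le_ent (show 15 * n + μ ≤ 26 * n + μ + 1 by omega)
  have u4 := log_choose_le_ent (show 14 * n + μ ≤ 27 * n + μ + 1 by omega)
  have u5 := log_choose_le_ent (show 13 * n + μ ≤ 28 * n + μ + 1 by omega)
  have u6 := log_choose_le_ent (show 12 * n + μ ≤ 29 * n + μ + 1 by omega)
  have u7 := log_choose_le_ent (show 11 * n + μ ≤ 30 * n + μ + 1 by omega)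
  push_cast at l0 u1 u2 u3 u4 u5 u6 u7 ⊢
  have hlogA : 0 ≤ Real.log (41 * n + 2 * μ + 2) := Real.log_nonneg (by linarith only [hn', f1])
  have hlogm : Real.log (41 * n + μ + 1) ≤ Real.log (42 * n) := Real.log_le_log (by positivity) (by linarith only [hn', f1])
  have aN := ent_ge_of_near (m := 41 * n + μ + 1) (k := (μ : ℝ)) (m' := 1036 / 25 * n) (k' := 11 / 25 * n) (M := 42 * n)
    (by linarith only [hn', f1, f2]) (by linarith only [hn', f1, f2]) (by linarith only [hn', f1, f2])
    (by linarith only [hn', f1, f2]) (by linarith only [hn', f1, f2]) (by linarith only [hn', f1, f2])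
    (by rw [abs_le]; constructor <;> linarith only [hn', f1, f2]) (by rw [abs_le]; constructor <;> linarith only [hn', f1, f2])
  have b1 := ent_ge_of_near (m := 611 / 25 * n) (k := 436 / 25 * n) (m' := 24 * n + μ + 1) (k' := 17 * n + μ) (M := 42 * n)
    (by linarith only [hn', f1, f2]) (by linarith only [hn', f1, f2]) (by linarith only [hn', f1, f2])
    (by linarith only [hn', f1, f2]) (by linarith only [hn', f1, f2]) (by linarith only [hn', f1, f2])
    (by rw [abs_le]; constructor <;> linarith only [hn', f1, f2]) (by rw [abs_le]; constructor <;> linarith only [hn', f1, f2])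
  have b2 := ent_ge_of_near (m := 636 / 25 * n) (k := 411 / 25 * n) (m' := 25 * n + μ + 1) (k' := 16 * n + μ) (M := 42 * n)
    (by linarith only [hn', f1, f2]) (by linarith only [hn', f1, f2]) (by linarith only [hn', f1, f2])
    (by linarith only [hn', f1, f2]) (by linarith only [hn', f1, f2]) (by linarith only [hn', f1, f2])
    (by rw [abs_le]; constructor <;> linarith only [hn', f1, f2]) (by rw [abs_le]; constructor <;> linarith only [hn', f1, f2])
  have b3 := ent_ge_of_near (m := 661 / 25 * n) (k := 386 / 25 * n) (m' := 26 * n + μ + 1) (k' := 15 * n + μ) (M := 42 * n)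
    (by linarith only [hn', f1, f2]) (by linarith only [hn', f1, f2]) (by linarith only [hn', f1, f2])
    (by linarith only [hn', f1, f2]) (by linarith only [hn', f1, f2]) (by linarith only [hn', f1, f2])
    (by rw [abs_le]; constructor <;> linarith only [hn', f1, f2]) (by rw [abs_le]; constructor <;> linarith only [hn', f1, f2])
  have b4 := ent_ge_of_near (m := 686 / 25 * n) (k := 361 / 25 * n) (m' := 27 * n + μ + 1) (k' := 14 * n + μ) (M := 42 * n)
    (by linarith only [hn', f1, f2]) (by linarith only [hn', f1, f2]) (by linarith only [hn', f1, f2])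
    (by linarith only [hn', f1, f2]) (by linarith only [hn', f1, f2]) (by linarith only [hn', f1, f2])
    (by rw [abs_le]; constructor <;> linarith only [hn', f1, f2]) (by rw [abs_le]; constructor <;> linarith only [hn', f1, f2])
  have b5 := ent_ge_of_near (m := 711 / 25 * n) (k := 336 / 25 * n) (m' := 28 * n + μ + 1) (k' := 13 * n + μ) (M := 42 * n)
    (by linarith only [hn', f1, f2]) (by linarith only [hn', f1, f2]) (by linarith only [hn', f1, f2])
    (by linarith only [hn', f1, f2]) (by linarith only [hn', f1, f2]) (by linarith only [hn', f1, f2])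
    (by rw [abs_le]; constructor <;> linarith only [hn', f1, f2]) (by rw [abs_le]; constructor <;> linarith only [hn', f1, f2])
  have b6 := ent_ge_of_near (m := 736 / 25 * n) (k := 311 / 25 * n) (m' := 29 * n + μ + 1) (k' := 12 * n + μ) (M := 42 * n)
    (by linarith only [hn', f1, f2]) (by linarith only [hn', f1, f2]) (by linarith only [hn', f1, f2])
    (by linarith only [hn', f1, f2]) (by linarith only [hn', f1, f2]) (by linarith only [hn', f1, f2])
    (by rw [abs_le]; constructor <;> linarith only [hn', f1, f2]) (by rw [abs_le]; constructor <;> linarith only [hn', f1, f2])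
  have b7 := ent_ge_of_near (m := 761 / 25 * n) (k := 286 / 25 * n) (m' := 30 * n + μ + 1) (k' := 11 * n + μ) (M := 42 * n)
    (by linarith only [hn', f1, f2]) (by linarith only [hn', f1, f2]) (by linarith only [hn', f1, f2])
    (by linarith only [hn', f1, f2]) (by linarith only [hn', f1, f2]) (by linarith only [hn', f1, f2])
    (by rw [abs_le]; constructor <;> linarith only [hn', f1, f2]) (by rw [abs_le]; constructor <;> linarith only [hn', f1, f2])
  have hn0 : (0 : ℝ) < n := by linarith
  have sN := ent_scale hn0 (1036 / 25) (11 / 25)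
  have s1 := ent_scale hn0 (611 / 25) (436 / 25)
  have s2 := ent_scale hn0 (636 / 25) (411 / 25)
  have s3 := ent_scale hn0 (661 / 25) (386 / 25)
  have s4 := ent_scale hn0 (686 / 25) (361 / 25)
  have s5 := ent_scale hn0 (711 / 25) (336 / 25)
  have s6 := ent_scale hn0 (736 / 25) (311 / 25)
  have s7 := ent_scale hn0 (761 / 25) (286 / 25)
  have hh : (n : ℝ) * hhat044 = n * ent (1036 / 25) (11 / 25) - (n * ent (611 / 25) (436 / 25) + n * ent (636 / 25) (411 / 25)
      + n * ent (661 / 25) (386 / 25) + n * ent (686 / 25) (361 / 25) + n * ent (711 / 25) (336 / 25)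
      + n * ent (736 / 25) (311 / 25) + n * ent (761 / 25) (286 / 25)) := by unfold hhat044; ring
  rw [hh, ← sN, ← s1, ← s2, ← s3, ← s4, ← s5, ← s6, ← s7]
  have hL : 0 ≤ Real.log (42 * n) := Real.log_nonneg (by linarith only [hn'])
  linarith only [l0, u1, u2, u3, u4, u5, u6, u7, hlogA, hlogm, hL, aN, b1, b2, b3, b4, b5, b6, b7]

/-- **Lower bound**: `F̃₇(b(a·n)) ≥ Z_n·exp(n·ĥ(11/25) − 97(1 + log 42n) − 2)` (`n ≥ 10`). -/
theorem vwpDual_record_lower {n : ℕ} (hn : 10 ≤ n) :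
    termNorm (41 * n) (Brec n) * Real.exp ((n : ℝ) * hhat044 - 97 * (1 + Real.log (42 * n)) - 2) ≤ vwpDual 7 (bRecord n) := by
  have h := term_le_vwpDual_record n (μstar n)
  have hT := termHat_pos (B₀ := 41 * n) (hreg_rec n) (μstar n)
  have hlow := (Real.le_log_iff_exp_le hT).1 (log_termHat_μstar_ge hn)
  exact le_trans (mul_le_mul_of_nonneg_left hlow (termNorm_pos _ _).le) h

/-! ### The two-sided exponential rate of `F̃₇(b(a·n))/Z_n` -/

/-- **Upper rate**: for every `ε > 0`, eventually `F̃₇(b(a·n)) ≤ Z_n·e^{(−125.5308 + ε)·n}`. -/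
theorem eventually_vwpDual_record_le_exp {ε : ℝ} (hε : 0 < ε) :
    ∀ᶠ n : ℕ in atTop, vwpDual 7 (bRecord n) ≤ termNorm (41 * n) (Brec n) * Real.exp ((-1255308 / 10000 + ε) * n) := by
  filter_upwards [eventually_ge_atTop 100,
    eventually_log_linear_le (a := 2) (b := 2) (by norm_num) (by norm_num) (show (0 : ℝ) < ε / 4 by positivity),
    eventually_log_linear_le (a := 42) (b := 0) (by norm_num) le_rfl (show (0 : ℝ) < ε / 400 by positivity),
    eventually_log_linear_le (a := 43) (b := 4) (by norm_num) (by norm_num) (show (0 : ℝ) < ε / 20 by positivity),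
    tendsto_natCast_atTop_atTop.eventually_ge_atTop (500 / ε)] with n hn h2 h42 h43 hbig
  refine (vwpDual_record_upper hn).trans (mul_le_mul_of_nonneg_left ?_ (termNorm_pos _ _).le)
  have hW : 2 * ((n : ℝ) + 1) * Wn n = Real.exp (Real.log (2 * n + 2) + ((n : ℝ) * (hhat04 + lambdaPlus / 20)
      + 2 * lambdaPlus + 96 * (1 + Real.log (42 * n)) + 9 / 2 * Real.log (43 * n + 4) + 14)) := by
    rw [Real.exp_add, Real.exp_log (by positivity)]; unfold Wn; ring
  rw [hW]
  apply Real.exp_le_exp.mpr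
  have hh := hhat04_le
  obtain ⟨lp0, lp1⟩ := lambdaPlus_bounds
  have hn' : (0 : ℝ) ≤ n := Nat.cast_nonneg n
  rw [add_zero] at h42
  have hc : (500 : ℝ) ≤ ε * n := by rwa [div_le_iff₀ hε, mul_comm] at hbig
  nlinarith

/-- **Lower rate**: for every `ε > 0`, eventually `Z_n·e^{(−125.5366 − ε)·n} ≤ F̃₇(b(a·n))`. -/
theorem eventually_exp_le_vwpDual_record {ε : ℝ} (hε : 0 < ε) :
    ∀ᶠ n : ℕ in atTop, termNorm (41 * n) (Brec n) * Real.exp ((-1255366 / 10000 - ε) * n) ≤ vwpDual 7 (bRecord n) := by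
  filter_upwards [eventually_ge_atTop 10,
    eventually_log_linear_le (a := 42) (b := 0) (by norm_num) le_rfl (show (0 : ℝ) < ε / 200 by positivity),
    tendsto_natCast_atTop_atTop.eventually_ge_atTop (200 / ε)] with n hn h42 hbig
  refine le_trans (mul_le_mul_of_nonneg_left ?_ (termNorm_pos _ _).le) (vwpDual_record_lower hn)
  apply Real.exp_le_exp.mpr
  have hh := hhat044_ge
  have hn' : (0 : ℝ) ≤ n := Nat.cast_nonneg n
  rw [add_zero] at h42
  have hc : (200 : ℝ) ≤ ε * n := by rwa [div_le_iff₀ hε, mul_comm] at hbig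
  nlinarith

end Summit.KontsevichZagierPeriods.Zeta5Search.RecordRay
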